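/-
Copyright: statement-level skeleton of a published paper (lit-balaban cell, Phase-2 proof seat p20 gen 5). No proof claims
beyond what the kernel checks below.
-/
import Literature.MathematicalPhysics.QuantumFieldTheory.Balaban1983to89.B3Sect3KernelsZeroTorus

/-!
# B3 — T. Bałaban, *(Higgs)₂,₃ quantum fields in a finite volume. III. Renormalization*, CMP **88** (1983) 411–445
[Balaban1983Higgs3], p. 437 [PDF 27]: **«|G^ξ_{j″}(0; y, y′)| ≦ O(1)e^{−δ₀|y−y′|}/|y − y′|» and «the corresponding inequalities
for derivatives» ON THE `L^{−j″}`-LATTICE — the SCALE-COVARIANT form (decay length `L^kη`, not the unit length) of the pointwise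
bounds for the zero-field resummed torus propagator `G_k(T_η, 0)`, value / one derivative / mixed second derivative, with and
without the diagonal**

statement-level skeleton of published theorems with citation tags; proofs where landed; nothing here is a claim about the Yang–Mills mass gap

CITATION HEADER (lean-in-tree rule).  Part of the lit-balaban TYPED SKELETON (HOME `run/shared/lean/pub/lit-balaban/`), Phase 2, seat p20
generation 5: rows **B3.Eq3.11-3.17** (p. 437, the kernel inputs of «(3.16) estimated by a constant») and **B3.Eq2.10** (torus model
instance) of `HOME/lit-balaban-r15/ROWS-B3.md` (fold owner r15, referee ref-4).  PDF held:
`paper:balaban1983-higgs-2-3-quantum-fields-finite-volume` (journal page = PDF + 410); p. 437 read in the OCR text.  Consumes BY NAME: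
p03 g4's `B3Ineq210ZeroTorus` (`pieceT`, `sum_pieceT` = (2.6), `ineq210_zeroTorus` = (2.10) value/derivative for the torus pieces),
p20 g5's `B3Ineq210MixedTorus` (`mixedT`, `ineq210_mixed_zeroTorus` = the mixed clause), p39 g5's `B3GkZeroBoxPointwise.scaleSum_le` /
`scaleSum_zero_le` (the sum over the scales), the torus distance `B5Ineq137Torus.T`; nothing re-proved.

WHY THIS FILE.  On p. 437 the vertex coefficient (3.15) is *"rescaled from the η-lattice to the L^{−j″}-lattice"*, `ξ = L^{−j″}`, and
the kernel bounds are stated THERE: `|y − y′|` is the distance in units of `L^{j″}η`, so «e^{−δ₀|y−y′|}» is the decay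
`e^{−δ₀·η|x−x′|_T/(L^{j″}η)}` at the physical scale `L^{j″}η` of the propagator `G_{j″}`.  The landed hypothesis-free bounds
`B3GkZeroTorusPointwise.gk_zero_torus_pointwise(_eta)` (p39 g5) keep only the decay `e^{−δ₁ε|x−x′|_T}` at the UNIT scale (they bound
`e^{−…/L^{k−1}}` by `e^{−…·ε}` through `L^{k−1}ε ≤ 1`), which after the rescaling to `ξ = L^{−k}` degenerates to the rate
`δ₁L^kε → 0`.  Here the scale is kept.

WHAT IS PROVED (all hypothesis-free, uniform in the volume `P = (d, L, m, K)` with `d, L` fixed and in `1 ≤ k ≤ K`; `d ≥ 3`, the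
constants `δ, c > 0` are functions of `d, L, a, m²`; `s_k = L^kε`, `dist = ε|x−x′|_T` the `η`-scaled sup torus distance, `G^η_k =
ε^{−d}G^ε_k` the print's normalisation):
* **`gk_zero_torus_scaled`** — for `x′ ≠ x`: `|G^η_k(x,x′)| ≤ c·dist^{−(d−2)}·e^{−δ·dist/s_k}`,
  `|(∂^ε_μG^η_k)(x,x′)| ≤ c·dist^{−(d−1)}·e^{−δ·dist/s_k}`, `|(∂^ε_μG^η_k∂^{ε*}_ν)(x,x′)| ≤ c·dist^{−d}·e^{−δ·dist/s_k}` — the three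
  printed laws (value, *"the corresponding inequalities for derivatives"*, and the mixed second difference needed by the `Σ_ν(∂_νM∂_ν^*)`
  term of (3.16)) WITH THE DECAY AT THE SCALE OF THE PROPAGATOR;
* **`gk_zero_torus_diag`** — for ALL `x, x′` (the diagonal included): `|G^η_k| ≤ c·ε^{−(d−2)}e^{−δ·dist/s_k}`,
  `|∂^ε_μG^η_k| ≤ c·ε^{−(d−1)}e^{−δ·dist/s_k}`, `|∂^ε_μG^η_k∂^{ε*}_ν| ≤ c·ε^{−d}e^{−δ·dist/s_k}` (the lattice cut-off of the singularity,
  used at coincident arguments in the convolutions of p. 437).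
Route = the print's: `G_k = Σ_{j<k}G_{(j)}` ((2.6), `sum_pieceT`), each piece bounded by (2.10) at its own scale `L^jε ≤ L^{k−1}ε`
(`ineq210_zeroTorus`, `ineq210_mixed_zeroTorus`), and the sum over the scales `Σ_{j<k}(L^j)^{−p}e^{−δn/L^j} ≤ C·n^{−p}e^{−(δ/2)n/L^{k−1}}`
(`scaleSum_le`, `p ≥ 1`) resp. `Σ_{j<k}(L^j)^{−p} ≤ (1−L^{−p})^{−1}` (`scaleSum_zero_le`); finally `n/L^{k−1} ≥ dist/s_k`.

HONEST SCOPE: zero external field (`A = B̃ = 0`, `U ≡ 1`), one real component, the whole torus (scope of `B4Thm110ZeroTorus`); `d ≥ 3`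
(at `d = 2` the value law is logarithmic, not printed on p. 437); sup torus distance (dominated by the print's Euclidean `|y−y′|`);
constants existential.  Mathlib + cited tree files only; theorems only, no definitions, no named facts; standard axioms.  Unit
`lit-balaban-p20-g5` (Phase-2 proof seat p20, gen 5), HOME `run/shared/lean/pub/lit-balaban/`, 2026-08-21.
-/

open scoped BigOperators

namespace Literature.MathematicalPhysics.QuantumFieldTheory.Balaban1983to89.B3GkZeroTorusScaled

open Matrix B1RG242Torus B5Display136Torus B5Ineq137Torus B4Ineq116Torus B4Thm110ZeroTorus
open B3GkZeroBoxPointwise B3Ineq210ZeroTorus B3Ineq210MixedTorus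

noncomputable section

section

variable (P : Params)

/-! ## §1 Kernel lemmas: entries of `G_k` as sums over the pieces; the profile of one piece; the scale window -/

/-- kernel: the torus distance of two distinct fine sites is positive. [folklore] -/
private theorem T_pos_of_ne {x x' : Site P 0} (hne : x' ≠ x) : 0 < T P 0 x x' := by
  rcases (T_nonneg P 0 x x').lt_or_eq with h | h
  · exact h
  · exact absurd (eq_of_T_eq_zero (P := P) h.symm).symm hne

/-- kernel: the mixed second difference is additive over a finite sum of matrices. [folklore] -/
private theorem mixedT_finset_sum {ι : Type*} (s : Finset ι) (t : ℝ) (μ ν : Fin P.d)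
    (G : ι → Matrix (Site P 0) (Site P 0) ℝ) :
    mixedT P t μ ν (∑ i ∈ s, G i) = ∑ i ∈ s, mixedT P t μ ν (G i) := by
  unfold mixedT
  rw [Matrix.mul_sum, Matrix.sum_mul]

/-- kernel: (2.6) entrywise — `G^ε_k(x,x′) = Σ_{j<k}G_{(j)}(x,x′)`, and the same for `∂^ε_μG^ε_k` and `∂^ε_μG^ε_k∂^{ε*}_ν`.
[cite: Balaban1983Higgs3, (2.6) p.424] -/
private theorem entries_eq_sum {a msq : ℝ} (ha : 0 < a) (hm : 0 ≤ msq) {k : ℕ} (hk : 1 ≤ k) (μ ν : Fin P.d)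
    (x x' : Site P 0) :
    (tower P a msq).G k x x' = ∑ j ∈ Finset.range k, pieceT P a msq k j x x' ∧
    (deriv P 0 P.eps μ * (tower P a msq).G k) x x' = ∑ j ∈ Finset.range k, (deriv P 0 P.eps μ * pieceT P a msq k j) x x' ∧
    mixedT P P.eps μ ν ((tower P a msq).G k) x x' = ∑ j ∈ Finset.range k, mixedT P P.eps μ ν (pieceT P a msq k j) x x' := by
  rw [← sum_pieceT (P := P) ha hm hk]
  refine ⟨by rw [Matrix.sum_apply], by rw [Matrix.mul_sum, Matrix.sum_apply], by rw [mixedT_finset_sum, Matrix.sum_apply]⟩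

/-- kernel: `(L^jε)^{−1}·(ε n) = n/L^j`. [folklore] -/
private theorem scale_inv_mul (j : ℕ) (n : ℝ) : (P.spacing j)⁻¹ * (P.eps * n) = n / (P.L : ℝ) ^ j := by
  unfold Params.spacing
  rw [mul_inv, mul_assoc, ← mul_assoc (P.eps)⁻¹, inv_mul_cancel₀ P.eps_pos.ne', one_mul, div_eq_inv_mul]

/-- kernel: the profile of one piece in natural powers — `(L^jε)^q((L^jε)^d)^{−1}e^{−δ(L^jε)^{−1}εn} = ε^q(ε^d)^{−1}·(L^j)^{−(d−q)}e^{−δn/L^j}`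
(`q ≤ d`). [folklore] -/
private theorem piece_profile {q : ℕ} (hq : q ≤ P.d) (j : ℕ) (δ n : ℝ) :
    P.spacing j ^ q * (P.spacing j ^ P.d)⁻¹ * Real.exp (-(δ * (P.spacing j)⁻¹ * (P.eps * n))) =
      P.eps ^ q * (P.eps ^ P.d)⁻¹ *
        (((P.L : ℝ) ^ j)⁻¹ ^ (P.d - q) * Real.exp (-(δ * n / (P.L : ℝ) ^ j))) := by
  have hL : (P.L : ℝ) ^ j ≠ 0 := (pow_pos P.cast_L_pos _).ne'
  have hε : P.eps ≠ 0 := P.eps_pos.ne'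
  rw [mul_assoc δ, scale_inv_mul, ← mul_div_assoc]
  have key : P.spacing j ^ q * (P.spacing j ^ P.d)⁻¹ =
      P.eps ^ q * (P.eps ^ P.d)⁻¹ * ((P.L : ℝ) ^ j)⁻¹ ^ (P.d - q) := by
    unfold Params.spacing
    obtain ⟨r, hr⟩ : ∃ r, P.d = q + r := ⟨P.d - q, by omega⟩
    rw [hr, Nat.add_sub_cancel_left, mul_pow, mul_pow, pow_add, pow_add, inv_pow]
    field_simp
  rw [key]
  ring

/-- kernel: `(L^jε)^{2−d} = (L^jε)²((L^jε)^d)^{−1}` (real exponent). [folklore] -/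
private theorem rpow_two_sub (j : ℕ) :
    P.spacing j ^ ((2 : ℝ) - (P.d : ℝ)) = P.spacing j ^ 2 * (P.spacing j ^ P.d)⁻¹ := by
  rw [Real.rpow_sub (P.spacing_pos j), div_eq_mul_inv, Real.rpow_natCast _ P.d, Real.rpow_two]

/-- kernel: `(L^jε)^{1−d} = (L^jε)((L^jε)^d)^{−1}`. [folklore] -/
private theorem rpow_one_sub (j : ℕ) :
    P.spacing j ^ ((1 : ℝ) - (P.d : ℝ)) = P.spacing j ^ 1 * (P.spacing j ^ P.d)⁻¹ := by
  rw [Real.rpow_sub (P.spacing_pos j), div_eq_mul_inv, Real.rpow_natCast _ P.d, Real.rpow_one, pow_one]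

/-- kernel: the scale window — `dist/s_k = εn/(L^kε) = n/L^k ≤ n/L^{k−1}` (`n ≥ 0`), so a decay in `n/L^{k−1}` is a decay in
`dist/s_k`. [folklore] -/
private theorem exp_window {k : ℕ} {m n : ℝ} (hm : 0 ≤ m) (hn : 0 ≤ n) :
    Real.exp (-(m * (n / (P.L : ℝ) ^ (k - 1)))) ≤ Real.exp (-(m * (P.spacing k)⁻¹ * (P.eps * n))) := by
  have hL1 : (1 : ℝ) ≤ P.L := (one_lt_cast_L P).le
  have hLk : (0 : ℝ) < (P.L : ℝ) ^ (k - 1) := by positivity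
  rw [mul_assoc m, scale_inv_mul, Real.exp_le_exp, neg_le_neg_iff]
  exact mul_le_mul_of_nonneg_left (div_le_div_of_nonneg_left hn hLk (pow_le_pow_right₀ hL1 (Nat.sub_le k 1))) hm

/-- kernel: a decay at a smaller rate is weaker (`0 ≤ u`, `δ′ ≤ δ`). [folklore] -/
private theorem exp_rate_le {δ δ' u : ℝ} (hδ : δ' ≤ δ) (hu : 0 ≤ u) : Real.exp (-(δ * u)) ≤ Real.exp (-(δ' * u)) := by
  rw [Real.exp_le_exp, neg_le_neg_iff]; exact mul_le_mul_of_nonneg_right hδ hu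

/-- kernel: the scale-sum constant `C_s(L, θ, p) = L/(L−1)e^{θ/2} + p!(θ/2)^{−p}(1 − e^{−(θ/2)(L−1)})^{−1}` is nonnegative (`L > 1`,
`θ > 0`). [folklore] -/
private theorem scaleConst_nonneg {L θ : ℝ} (hL : 1 < L) (hθ : 0 < θ) (p : ℕ) :
    0 ≤ L / (L - 1) * Real.exp (θ / 2) + (p.factorial : ℝ) / (θ / 2) ^ p * (1 - Real.exp (-(θ / 2 * (L - 1))))⁻¹ := by
  have hL0 : 0 < L - 1 := by linarith
  have hq : 0 < 1 - Real.exp (-(θ / 2 * (L - 1))) := by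
    have : Real.exp (-(θ / 2 * (L - 1))) < 1 := Real.exp_lt_one_iff.2 (by nlinarith)
    linarith
  positivity

/-- kernel: the diagonal scale-sum constant `(1 − L^{−p})^{−1}` is nonnegative (`L > 1`, `p ≥ 1`). [folklore] -/
private theorem diagConst_nonneg {L : ℝ} (hL : 1 < L) {p : ℕ} (hp : 1 ≤ p) : 0 ≤ (1 - (L ^ p)⁻¹)⁻¹ := by
  have h1 : (L ^ p)⁻¹ < 1 := inv_lt_one_of_one_lt₀ (one_lt_pow₀ hL (by omega))
  exact inv_nonneg.mpr (by linarith)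

/-- **THE SUM OVER THE PIECES, OFF THE DIAGONAL.**  If the `k` scale pieces `f_j` (`j < k`) of an entry obey the (2.10)-type bound
`|f_j| ≤ C(L^jε)^q((L^jε)^d)^{−1}e^{−δ₀(L^jε)^{−1}εn}` with `q + 1 ≤ d` and `n > 0`, then
`|Σ_{j<k}f_j| ≤ C·C_s(L,δ₀,d−q)·(εn)^{−(d−q)}·e^{−(δ₀/2)(L^kε)^{−1}εn}` — `scaleSum_le` and the scale window.
[cite: Balaban1983Higgs3, (2.6) p.424, (2.10) p.426, p.437] -/
private theorem pieces_sum_le {q : ℕ} (hqd : q + 1 ≤ P.d) (k : ℕ) {δ₀ C n : ℝ} (hδ₀ : 0 < δ₀) (hC : 0 ≤ C)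
    (hn : 0 < n) (f : ℕ → ℝ)
    (hf : ∀ j, |f j| ≤ C * (P.spacing j ^ q * (P.spacing j ^ P.d)⁻¹) *
      Real.exp (-(δ₀ * (P.spacing j)⁻¹ * (P.eps * n)))) :
    |∑ j ∈ Finset.range k, f j| ≤
      C * ((P.L : ℝ) / ((P.L : ℝ) - 1) * Real.exp (δ₀ / 2) +
          ((P.d - q).factorial : ℝ) / (δ₀ / 2) ^ (P.d - q) * (1 - Real.exp (-(δ₀ / 2 * ((P.L : ℝ) - 1))))⁻¹) *
        (P.eps * n)⁻¹ ^ (P.d - q) * Real.exp (-(δ₀ / 2 * (P.spacing k)⁻¹ * (P.eps * n))) := by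
  have hL1 : (1 : ℝ) < P.L := one_lt_cast_L P
  have hε : 0 < P.eps := P.eps_pos
  set Cs : ℝ := (P.L : ℝ) / ((P.L : ℝ) - 1) * Real.exp (δ₀ / 2) +
      ((P.d - q).factorial : ℝ) / (δ₀ / 2) ^ (P.d - q) * (1 - Real.exp (-(δ₀ / 2 * ((P.L : ℝ) - 1))))⁻¹ with hCs
  have hCs0 : 0 ≤ Cs := scaleConst_nonneg hL1 hδ₀ _
  -- the sum over the scales
  have hsum := scaleSum_le hL1 hδ₀ (show 1 ≤ P.d - q by omega) k hn
  have hwin := exp_window P (k := k) (show (0 : ℝ) ≤ δ₀ / 2 by positivity) hn.le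
  -- ε^q(ε^d)^{−1}n^{−(d−q)} = (εn)^{−(d−q)}
  have halg : P.eps ^ q * (P.eps ^ P.d)⁻¹ * n⁻¹ ^ (P.d - q) = (P.eps * n)⁻¹ ^ (P.d - q) := by
    obtain ⟨r, hr⟩ : ∃ r, P.d = q + r := ⟨P.d - q, by omega⟩
    rw [hr, Nat.add_sub_cancel_left, pow_add, mul_inv, ← mul_assoc, mul_inv_cancel₀ (pow_ne_zero _ hε.ne'), one_mul,
      mul_inv, mul_pow, ← inv_pow]
  calc |∑ j ∈ Finset.range k, f j| ≤ ∑ j ∈ Finset.range k, |f j| := Finset.abs_sum_le_sum_abs _ _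
    _ ≤ ∑ j ∈ Finset.range k, C * (P.spacing j ^ q * (P.spacing j ^ P.d)⁻¹) *
          Real.exp (-(δ₀ * (P.spacing j)⁻¹ * (P.eps * n))) := Finset.sum_le_sum fun j _ => hf j
    _ = C * (P.eps ^ q * (P.eps ^ P.d)⁻¹) *
          ∑ j ∈ Finset.range k, ((P.L : ℝ) ^ j)⁻¹ ^ (P.d - q) * Real.exp (-(δ₀ * n / (P.L : ℝ) ^ j)) := by
        rw [Finset.mul_sum]
        refine Finset.sum_congr rfl fun j _ => ?_
        rw [mul_assoc C, piece_profile P (by omega) j δ₀ n]; ring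
    _ ≤ C * (P.eps ^ q * (P.eps ^ P.d)⁻¹) * (Cs * n⁻¹ ^ (P.d - q) * Real.exp (-(δ₀ / 2 * (n / (P.L : ℝ) ^ (k - 1))))) :=
        mul_le_mul_of_nonneg_left hsum (by positivity)
    _ ≤ C * (P.eps ^ q * (P.eps ^ P.d)⁻¹) * (Cs * n⁻¹ ^ (P.d - q) * Real.exp (-(δ₀ / 2 * (P.spacing k)⁻¹ * (P.eps * n)))) := by
        refine mul_le_mul_of_nonneg_left (mul_le_mul_of_nonneg_left hwin (by positivity)) (by positivity)
    _ = C * Cs * (P.eps ^ q * (P.eps ^ P.d)⁻¹ * n⁻¹ ^ (P.d - q)) * Real.exp (-(δ₀ / 2 * (P.spacing k)⁻¹ * (P.eps * n))) := by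
        ring
    _ = _ := by rw [halg]

/-- **THE SUM OVER THE PIECES, DIAGONAL INCLUDED.**  Under the same piece bounds with `n ≥ 0` (possibly `0`):
`|Σ_{j<k}f_j| ≤ C·(1 − L^{−(d−q)})^{−1}·ε^{−(d−q)}·e^{−δ₀(L^kε)^{−1}εn}` — every piece decays at least at the rate of the last scale
`L^{k−1}ε`, and `Σ_{j<k}(L^j)^{−(d−q)} ≤ (1 − L^{−(d−q)})^{−1}` (`scaleSum_zero_le`). [cite: Balaban1983Higgs3, (2.6) p.424, (2.10) p.426] -/
private theorem pieces_sum_le_diag {q : ℕ} (hqd : q + 1 ≤ P.d) (k : ℕ) {δ₀ C n : ℝ} (hδ₀ : 0 < δ₀) (hC : 0 ≤ C)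
    (hn : 0 ≤ n) (f : ℕ → ℝ)
    (hf : ∀ j, |f j| ≤ C * (P.spacing j ^ q * (P.spacing j ^ P.d)⁻¹) *
      Real.exp (-(δ₀ * (P.spacing j)⁻¹ * (P.eps * n)))) :
    |∑ j ∈ Finset.range k, f j| ≤
      C * (1 - (((P.L : ℝ) ^ (P.d - q)))⁻¹)⁻¹ * (P.eps ^ (P.d - q))⁻¹ *
        Real.exp (-(δ₀ * (P.spacing k)⁻¹ * (P.eps * n))) := by
  have hL1 : (1 : ℝ) < P.L := one_lt_cast_L P
  have hL0 : (0 : ℝ) < P.L := P.cast_L_pos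
  have hε : 0 < P.eps := P.eps_pos
  set Cz : ℝ := (1 - (((P.L : ℝ) ^ (P.d - q)))⁻¹)⁻¹ with hCz
  have hCz0 : 0 ≤ Cz := diagConst_nonneg hL1 (show 1 ≤ P.d - q by omega)
  have hsum := scaleSum_zero_le hL1 (show 1 ≤ P.d - q by omega) k
  have hwin := exp_window P (k := k) hδ₀.le hn
  -- every piece decays at least at the last scale
  have hlast : ∀ j ∈ Finset.range k,
      Real.exp (-(δ₀ * n / (P.L : ℝ) ^ j)) ≤ Real.exp (-(δ₀ * (n / (P.L : ℝ) ^ (k - 1)))) := by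
    intro j hj
    have hjk : j ≤ k - 1 := by have := Finset.mem_range.mp hj; omega
    rw [mul_div_assoc, Real.exp_le_exp, neg_le_neg_iff]
    exact mul_le_mul_of_nonneg_left
      (div_le_div_of_nonneg_left hn (pow_pos hL0 _) (pow_le_pow_right₀ hL1.le hjk)) hδ₀.le
  have halg : P.eps ^ q * (P.eps ^ P.d)⁻¹ = (P.eps ^ (P.d - q))⁻¹ := by
    obtain ⟨r, hr⟩ : ∃ r, P.d = q + r := ⟨P.d - q, by omega⟩
    rw [hr, Nat.add_sub_cancel_left, pow_add, mul_inv, ← mul_assoc, mul_inv_cancel₀ (pow_ne_zero _ hε.ne'), one_mul]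
  calc |∑ j ∈ Finset.range k, f j| ≤ ∑ j ∈ Finset.range k, |f j| := Finset.abs_sum_le_sum_abs _ _
    _ ≤ ∑ j ∈ Finset.range k, C * (P.spacing j ^ q * (P.spacing j ^ P.d)⁻¹) *
          Real.exp (-(δ₀ * (P.spacing j)⁻¹ * (P.eps * n))) := Finset.sum_le_sum fun j _ => hf j
    _ = C * (P.eps ^ q * (P.eps ^ P.d)⁻¹) *
          ∑ j ∈ Finset.range k, ((P.L : ℝ) ^ j)⁻¹ ^ (P.d - q) * Real.exp (-(δ₀ * n / (P.L : ℝ) ^ j)) := by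
        rw [Finset.mul_sum]
        refine Finset.sum_congr rfl fun j _ => ?_
        rw [mul_assoc C, piece_profile P (by omega) j δ₀ n]; ring
    _ ≤ C * (P.eps ^ q * (P.eps ^ P.d)⁻¹) *
          ∑ j ∈ Finset.range k, ((P.L : ℝ) ^ j)⁻¹ ^ (P.d - q) * Real.exp (-(δ₀ * (n / (P.L : ℝ) ^ (k - 1)))) := by
        refine mul_le_mul_of_nonneg_left (Finset.sum_le_sum fun j hj => ?_) (by positivity)
        exact mul_le_mul_of_nonneg_left (hlast j hj) (by positivity)
    _ ≤ C * (P.eps ^ q * (P.eps ^ P.d)⁻¹) * (Cz * Real.exp (-(δ₀ * (P.spacing k)⁻¹ * (P.eps * n)))) := by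
        rw [← Finset.sum_mul]
        exact mul_le_mul_of_nonneg_left (mul_le_mul hsum hwin (Real.exp_pos _).le hCz0) (by positivity)
    _ = _ := by rw [halg]; ring

/-! ## §2 The scale-covariant pointwise bounds, off the diagonal -/

/-- **[Balaban1983Higgs3] p. 437 [PDF 27] — «|G^ξ_{j″}(0; y, y′)| ≦ O(1)e^{−δ₀|y−y′|}/|y − y′|» and «the corresponding inequalities
for derivatives» ON THE `L^{−j″}`-LATTICE, FOR THE ZERO-FIELD TORUS PROPAGATOR, SCALE KEPT, HYPOTHESIS-FREE AND UNIFORM.**  For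
`d ≥ 3`, odd `L > 1`, `a > 0`, `m² ≥ 0` there are `δ, c > 0` (functions of `d, L, a, m²`) such that for EVERY volume
`P = (d, L, m, K)`, every scale `1 ≤ k ≤ K` and all fine sites `x′ ≠ x` (`dist = ε|x−x′|_T`, `s_k = L^kε`, `G^η_k = ε^{−d}G^ε_k`):
`|G^η_k(x,x′)| ≤ c·dist^{−(d−2)}·e^{−δ·dist/s_k}`, `|(∂^ε_μG^η_k)(x,x′)| ≤ c·dist^{−(d−1)}·e^{−δ·dist/s_k}` and
`|(∂^ε_μG^η_k∂^{ε*}_ν)(x,x′)| ≤ c·dist^{−d}·e^{−δ·dist/s_k}` — in the units of the `ξ = L^{−k}`-lattice (`|y−y′| = dist/s_k`) exactly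
the printed `O(1)e^{−δ₀|y−y′|}/|y−y′|^{d−2, d−1, d}` laws.  Route: (2.6) `G_k = Σ_{j<k}G_{(j)}` + (2.10) for each piece at its
scale + the sum over the scales (`pieces_sum_le`). [cite: Balaban1983Higgs3, p.437 [PDF 27], (2.6) p.424, (2.10) p.426] -/
theorem gk_zero_torus_scaled (d L : ℕ) (hd : 3 ≤ d) (hL : Odd L ∧ 1 < L) {a : ℝ} (ha : 0 < a) {msq : ℝ}
    (hmsq : 0 ≤ msq) :
    ∃ δ c : ℝ, 0 < δ ∧ 0 < c ∧ ∀ (P : Params), P.d = d → P.L = L →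
      ∀ k : ℕ, 1 ≤ k → k ≤ P.K → ∀ (x x' : Site P 0), x' ≠ x →
        |(P.eps ^ P.d)⁻¹ * (tower P a msq).G k x x'| ≤
            c * (P.eps * T P 0 x x')⁻¹ ^ (d - 2) * Real.exp (-(δ * (P.spacing k)⁻¹ * (P.eps * T P 0 x x'))) ∧
        (∀ μ : Fin P.d, |(P.eps ^ P.d)⁻¹ * (deriv P 0 P.eps μ * (tower P a msq).G k) x x'| ≤
            c * (P.eps * T P 0 x x')⁻¹ ^ (d - 1) * Real.exp (-(δ * (P.spacing k)⁻¹ * (P.eps * T P 0 x x')))) ∧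
        (∀ μ ν : Fin P.d, |(P.eps ^ P.d)⁻¹ * mixedT P P.eps μ ν ((tower P a msq).G k) x x'| ≤
            c * (P.eps * T P 0 x x')⁻¹ ^ d * Real.exp (-(δ * (P.spacing k)⁻¹ * (P.eps * T P 0 x x')))) := by
  obtain ⟨δ₁, C₁, hδ₁, hC₁, h1⟩ := ineq210_zeroTorus d L (by omega) hL ha hmsq
  obtain ⟨δ₂, C₂, hδ₂, hC₂, h2⟩ := ineq210_mixed_zeroTorus d L (by omega) hL ha hmsq
  have hL1 : (1 : ℝ) < L := by exact_mod_cast hL.2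
  set δ₀ : ℝ := min δ₁ δ₂ with hδ₀def
  have hδ₀ : 0 < δ₀ := lt_min hδ₁ hδ₂
  -- the scale-sum constants at the three powers d − 2, d − 1, d
  set Cs : ℕ → ℝ := fun p => (L : ℝ) / ((L : ℝ) - 1) * Real.exp (δ₀ / 2) +
      (p.factorial : ℝ) / (δ₀ / 2) ^ p * (1 - Real.exp (-(δ₀ / 2 * ((L : ℝ) - 1))))⁻¹ with hCsdef
  have hCs : ∀ p, 0 ≤ Cs p := fun p => scaleConst_nonneg hL1 hδ₀ p
  refine ⟨δ₀ / 2, (C₁ + C₂) * (Cs (d - 2) + Cs (d - 1) + Cs d) + 1, by positivity,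
    by have := hCs (d - 2); have := hCs (d - 1); have := hCs d; positivity, ?_⟩
  intro P hPd hPL k hk1 hkK x x' hne
  have h1P := h1 P hPd hPL k hk1 hkK
  have h2P := h2 P hPd hPL k hk1 hkK
  subst hPd hPL
  set n : ℝ := T P 0 x x' with hndef
  have hn : 0 < n := T_pos_of_ne P hne
  have hu : 0 ≤ P.eps * n := mul_nonneg P.eps_pos.le hn.le
  -- the (2.10) bounds of the pieces, in natural powers, at the common rate δ₀
  have hsc : ∀ j, 0 ≤ (P.spacing j)⁻¹ * (P.eps * n) := fun j => mul_nonneg (inv_pos.mpr (P.spacing_pos j)).le hu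
  have hv : ∀ j, |(P.eps ^ P.d)⁻¹ * pieceT P a msq k j x x'| ≤ C₁ * (P.spacing j ^ 2 * (P.spacing j ^ P.d)⁻¹) *
      Real.exp (-(δ₀ * (P.spacing j)⁻¹ * (P.eps * n))) := by
    intro j
    have h : (P.eps ^ P.d)⁻¹ * |pieceT P a msq k j x x'| ≤ C₁ * P.spacing j ^ ((2 : ℝ) - (P.d : ℝ)) *
        Real.exp (-(δ₁ * (P.spacing j)⁻¹ * (P.eps * T P 0 x x'))) := (h1P j x x').1
    rw [abs_mul, abs_of_pos (inv_pos.mpr (pow_pos P.eps_pos _)), ← rpow_two_sub]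
    refine h.trans (mul_le_mul_of_nonneg_left ?_ (mul_nonneg hC₁.le (Real.rpow_nonneg (P.spacing_pos j).le _)))
    rw [mul_assoc, mul_assoc]; exact exp_rate_le (min_le_left _ _) (hsc j)
  have hder : ∀ μ j, |(P.eps ^ P.d)⁻¹ * (deriv P 0 P.eps μ * pieceT P a msq k j) x x'| ≤
      C₁ * (P.spacing j ^ 1 * (P.spacing j ^ P.d)⁻¹) * Real.exp (-(δ₀ * (P.spacing j)⁻¹ * (P.eps * n))) := by
    intro μ j
    have h : (P.eps ^ P.d)⁻¹ * |(deriv P 0 P.eps μ * pieceT P a msq k j) x x'| ≤ C₁ * P.spacing j ^ ((1 : ℝ) - (P.d : ℝ)) *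
        Real.exp (-(δ₁ * (P.spacing j)⁻¹ * (P.eps * T P 0 x x'))) := (h1P j x x').2 μ
    rw [abs_mul, abs_of_pos (inv_pos.mpr (pow_pos P.eps_pos _)), ← rpow_one_sub]
    refine h.trans (mul_le_mul_of_nonneg_left ?_ (mul_nonneg hC₁.le (Real.rpow_nonneg (P.spacing_pos j).le _)))
    rw [mul_assoc, mul_assoc]; exact exp_rate_le (min_le_left _ _) (hsc j)
  have hmix : ∀ μ ν j, |(P.eps ^ P.d)⁻¹ * mixedT P P.eps μ ν (pieceT P a msq k j) x x'| ≤
      C₂ * (P.spacing j ^ 0 * (P.spacing j ^ P.d)⁻¹) * Real.exp (-(δ₀ * (P.spacing j)⁻¹ * (P.eps * n))) := by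
    intro μ ν j
    have h := h2P j μ ν x x'
    rw [abs_mul, abs_of_pos (inv_pos.mpr (pow_pos P.eps_pos _)), pow_zero, one_mul]
    refine h.trans (mul_le_mul_of_nonneg_left ?_ (mul_nonneg hC₂.le (inv_pos.mpr (pow_pos (P.spacing_pos j) _)).le))
    rw [mul_assoc, mul_assoc]; exact exp_rate_le (min_le_right _ _) (hsc j)
  -- assembling
  have hE : 0 ≤ Real.exp (-(δ₀ / 2 * (P.spacing k)⁻¹ * (P.eps * n))) := (Real.exp_pos _).le
  have h2 := hCs (P.d - 2); have h1 := hCs (P.d - 1); have h0 := hCs P.d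
  have hc1 : C₁ * Cs (P.d - 2) ≤ (C₁ + C₂) * (Cs (P.d - 2) + Cs (P.d - 1) + Cs P.d) + 1 := by nlinarith
  have hc2 : C₁ * Cs (P.d - 1) ≤ (C₁ + C₂) * (Cs (P.d - 2) + Cs (P.d - 1) + Cs P.d) + 1 := by nlinarith
  have hc3 : C₂ * Cs P.d ≤ (C₁ + C₂) * (Cs (P.d - 2) + Cs (P.d - 1) + Cs P.d) + 1 := by nlinarith
  refine ⟨?_, fun μ => ?_, fun μ ν => ?_⟩
  · rw [(entries_eq_sum P ha hmsq hk1 ⟨0, P.hd⟩ ⟨0, P.hd⟩ x x').1, Finset.mul_sum]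
    refine (pieces_sum_le P (q := 2) (by omega) k hδ₀ hC₁.le hn _ hv).trans ?_
    exact mul_le_mul_of_nonneg_right (mul_le_mul_of_nonneg_right hc1 (by positivity)) hE
  · rw [(entries_eq_sum P ha hmsq hk1 μ μ x x').2.1, Finset.mul_sum]
    refine (pieces_sum_le P (q := 1) (by omega) k hδ₀ hC₁.le hn _ (hder μ)).trans ?_
    exact mul_le_mul_of_nonneg_right (mul_le_mul_of_nonneg_right hc2 (by positivity)) hE
  · rw [(entries_eq_sum P ha hmsq hk1 μ ν x x').2.2, Finset.mul_sum]
    refine (pieces_sum_le P (q := 0) (by omega) k hδ₀ hC₂.le hn _ (hmix μ ν)).trans ?_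
    rw [Nat.sub_zero]
    exact mul_le_mul_of_nonneg_right (mul_le_mul_of_nonneg_right hc3 (by positivity)) hE

end

/-! ## §3 The same bounds with the diagonal included (the lattice cut-off of the singularity) -/

/-- **The zero-field torus propagator with the diagonal included**: for `d ≥ 3`, odd `L > 1`, `a > 0`, `m² ≥ 0` there are
`δ, c > 0` such that for every volume, every `1 ≤ k ≤ K` and ALL fine sites `x, x′` (also `x = x′`):
`|G^η_k(x,x′)| ≤ c·ε^{−(d−2)}·e^{−δ·dist/s_k}`, `|(∂^ε_μG^η_k)(x,x′)| ≤ c·ε^{−(d−1)}·e^{−δ·dist/s_k}`,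
`|(∂^ε_μG^η_k∂^{ε*}_ν)(x,x′)| ≤ c·ε^{−d}·e^{−δ·dist/s_k}` (`dist = ε|x−x′|_T`, `s_k = L^kε`) — the singularity `dist^{−p}` of §2 cut
off at the lattice spacing `dist ≥ ε`, as needed at coincident arguments of the lattice convolutions behind «we can estimate (3.16)
by a constant» (p. 437).  Route: (2.6) + (2.10) for each piece + `Σ_{j<k}(L^j)^{−p} ≤ (1−L^{−p})^{−1}` (`pieces_sum_le_diag`).
[cite: Balaban1983Higgs3, p.437 [PDF 27], (2.6) p.424, (2.10) p.426] -/
theorem gk_zero_torus_diag (d L : ℕ) (hd : 3 ≤ d) (hL : Odd L ∧ 1 < L) {a : ℝ} (ha : 0 < a) {msq : ℝ}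
    (hmsq : 0 ≤ msq) :
    ∃ δ c : ℝ, 0 < δ ∧ 0 < c ∧ ∀ (P : Params), P.d = d → P.L = L →
      ∀ k : ℕ, 1 ≤ k → k ≤ P.K → ∀ (x x' : Site P 0),
        |(P.eps ^ P.d)⁻¹ * (tower P a msq).G k x x'| ≤
            c * (P.eps ^ (d - 2))⁻¹ * Real.exp (-(δ * (P.spacing k)⁻¹ * (P.eps * T P 0 x x'))) ∧
        (∀ μ : Fin P.d, |(P.eps ^ P.d)⁻¹ * (deriv P 0 P.eps μ * (tower P a msq).G k) x x'| ≤
            c * (P.eps ^ (d - 1))⁻¹ * Real.exp (-(δ * (P.spacing k)⁻¹ * (P.eps * T P 0 x x')))) ∧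
        (∀ μ ν : Fin P.d, |(P.eps ^ P.d)⁻¹ * mixedT P P.eps μ ν ((tower P a msq).G k) x x'| ≤
            c * (P.eps ^ d)⁻¹ * Real.exp (-(δ * (P.spacing k)⁻¹ * (P.eps * T P 0 x x')))) := by
  obtain ⟨δ₁, C₁, hδ₁, hC₁, h1⟩ := ineq210_zeroTorus d L (by omega) hL ha hmsq
  obtain ⟨δ₂, C₂, hδ₂, hC₂, h2⟩ := ineq210_mixed_zeroTorus d L (by omega) hL ha hmsq
  have hL1 : (1 : ℝ) < L := by exact_mod_cast hL.2
  set δ₀ : ℝ := min δ₁ δ₂ with hδ₀def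
  have hδ₀ : 0 < δ₀ := lt_min hδ₁ hδ₂
  -- the diagonal scale-sum constants at the three powers d − 2, d − 1, d
  set Cz : ℕ → ℝ := fun p => (1 - (((L : ℝ) ^ p))⁻¹)⁻¹ with hCzdef
  have hCz2 : 0 ≤ Cz (d - 2) := diagConst_nonneg hL1 (by omega)
  have hCz1 : 0 ≤ Cz (d - 1) := diagConst_nonneg hL1 (by omega)
  have hCz0 : 0 ≤ Cz d := diagConst_nonneg hL1 (by omega)
  refine ⟨δ₀, (C₁ + C₂) * (Cz (d - 2) + Cz (d - 1) + Cz d) + 1, hδ₀, by positivity, ?_⟩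
  intro P hPd hPL k hk1 hkK x x'
  have h1P := h1 P hPd hPL k hk1 hkK
  have h2P := h2 P hPd hPL k hk1 hkK
  subst hPd hPL
  set n : ℝ := T P 0 x x' with hndef
  have hn : 0 ≤ n := T_nonneg P 0 x x'
  have hε : 0 < P.eps := P.eps_pos
  have hu : 0 ≤ P.eps * n := mul_nonneg P.eps_pos.le hn
  have hsc : ∀ j, 0 ≤ (P.spacing j)⁻¹ * (P.eps * n) := fun j => mul_nonneg (inv_pos.mpr (P.spacing_pos j)).le hu
  have hv : ∀ j, |(P.eps ^ P.d)⁻¹ * pieceT P a msq k j x x'| ≤ C₁ * (P.spacing j ^ 2 * (P.spacing j ^ P.d)⁻¹) *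
      Real.exp (-(δ₀ * (P.spacing j)⁻¹ * (P.eps * n))) := by
    intro j
    have h : (P.eps ^ P.d)⁻¹ * |pieceT P a msq k j x x'| ≤ C₁ * P.spacing j ^ ((2 : ℝ) - (P.d : ℝ)) *
        Real.exp (-(δ₁ * (P.spacing j)⁻¹ * (P.eps * T P 0 x x'))) := (h1P j x x').1
    rw [abs_mul, abs_of_pos (inv_pos.mpr (pow_pos P.eps_pos _)), ← rpow_two_sub]
    refine h.trans (mul_le_mul_of_nonneg_left ?_ (mul_nonneg hC₁.le (Real.rpow_nonneg (P.spacing_pos j).le _)))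
    rw [mul_assoc, mul_assoc]; exact exp_rate_le (min_le_left _ _) (hsc j)
  have hder : ∀ μ j, |(P.eps ^ P.d)⁻¹ * (deriv P 0 P.eps μ * pieceT P a msq k j) x x'| ≤
      C₁ * (P.spacing j ^ 1 * (P.spacing j ^ P.d)⁻¹) * Real.exp (-(δ₀ * (P.spacing j)⁻¹ * (P.eps * n))) := by
    intro μ j
    have h : (P.eps ^ P.d)⁻¹ * |(deriv P 0 P.eps μ * pieceT P a msq k j) x x'| ≤ C₁ * P.spacing j ^ ((1 : ℝ) - (P.d : ℝ)) *
        Real.exp (-(δ₁ * (P.spacing j)⁻¹ * (P.eps * T P 0 x x'))) := (h1P j x x').2 μ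
    rw [abs_mul, abs_of_pos (inv_pos.mpr (pow_pos P.eps_pos _)), ← rpow_one_sub]
    refine h.trans (mul_le_mul_of_nonneg_left ?_ (mul_nonneg hC₁.le (Real.rpow_nonneg (P.spacing_pos j).le _)))
    rw [mul_assoc, mul_assoc]; exact exp_rate_le (min_le_left _ _) (hsc j)
  have hmix : ∀ μ ν j, |(P.eps ^ P.d)⁻¹ * mixedT P P.eps μ ν (pieceT P a msq k j) x x'| ≤
      C₂ * (P.spacing j ^ 0 * (P.spacing j ^ P.d)⁻¹) * Real.exp (-(δ₀ * (P.spacing j)⁻¹ * (P.eps * n))) := by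
    intro μ ν j
    have h := h2P j μ ν x x'
    rw [abs_mul, abs_of_pos (inv_pos.mpr (pow_pos P.eps_pos _)), pow_zero, one_mul]
    refine h.trans (mul_le_mul_of_nonneg_left ?_ (mul_nonneg hC₂.le (inv_pos.mpr (pow_pos (P.spacing_pos j) _)).le))
    rw [mul_assoc, mul_assoc]; exact exp_rate_le (min_le_right _ _) (hsc j)
  have hE : 0 ≤ Real.exp (-(δ₀ * (P.spacing k)⁻¹ * (P.eps * n))) := (Real.exp_pos _).le
  have hc1 : C₁ * Cz (P.d - 2) ≤ (C₁ + C₂) * (Cz (P.d - 2) + Cz (P.d - 1) + Cz P.d) + 1 := by nlinarith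
  have hc2 : C₁ * Cz (P.d - 1) ≤ (C₁ + C₂) * (Cz (P.d - 2) + Cz (P.d - 1) + Cz P.d) + 1 := by nlinarith
  have hc3 : C₂ * Cz P.d ≤ (C₁ + C₂) * (Cz (P.d - 2) + Cz (P.d - 1) + Cz P.d) + 1 := by nlinarith
  refine ⟨?_, fun μ => ?_, fun μ ν => ?_⟩
  · rw [(entries_eq_sum P ha hmsq hk1 ⟨0, P.hd⟩ ⟨0, P.hd⟩ x x').1, Finset.mul_sum]
    refine (pieces_sum_le_diag P (q := 2) (by omega) k hδ₀ hC₁.le hn _ hv).trans ?_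
    exact mul_le_mul_of_nonneg_right (mul_le_mul_of_nonneg_right hc1 (by positivity)) hE
  · rw [(entries_eq_sum P ha hmsq hk1 μ μ x x').2.1, Finset.mul_sum]
    refine (pieces_sum_le_diag P (q := 1) (by omega) k hδ₀ hC₁.le hn _ (hder μ)).trans ?_
    exact mul_le_mul_of_nonneg_right (mul_le_mul_of_nonneg_right hc2 (by positivity)) hE
  · rw [(entries_eq_sum P ha hmsq hk1 μ ν x x').2.2, Finset.mul_sum]
    refine (pieces_sum_le_diag P (q := 0) (by omega) k hδ₀ hC₂.le hn _ (hmix μ ν)).trans ?_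
    rw [Nat.sub_zero]
    exact mul_le_mul_of_nonneg_right (mul_le_mul_of_nonneg_right hc3 (by positivity)) hE

end

end Literature.MathematicalPhysics.QuantumFieldTheory.Balaban1983to89.B3GkZeroTorusScaled
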